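import Summits.CriticalPhenomena.PercolationContinuityZ3.Theses.PercNearOneGluing
import Literature.Probability.Percolation.PercolationProofs
import Literature.Probability.Percolation.ConditionalPositiveAssociationProofs
import Literature.Probability.Percolation.TwoClusterConditionalAssociationProofs

/-! TTRL-lite variant V121 of stmt-CriticalPhenomena-4576 -/

namespace Summit.CriticalPhenomena.PercolationContinuityZ3.Theorems

open MeasureTheory Literature.Probability.LatticeModels Literature.Probability.Percolation
open scoped Classical BigOperators

/-- TTRL-lite variant V121 (move `small_case`, `n ≤ 2`) of `stmt-CriticalPhenomena-4576`
(the good-step induction form of `AdditiveGluing`). For `n ≤ 2` the hypotheses are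
contradictory: `b ∈ A`, `o ∉ A` and a witness `y ∉ A` with `y ≠ o` give three pairwise distinct
elements `o, b, y` of `Fin n`, impossible when `n ≤ 2`; so the statement holds vacuously. -/
theorem goodStep_var121 :
    ∀ (n : ℕ) (w : Sym2 (Fin n) → unitInterval) (A : Finset (Fin n)) (o b : Fin n), n ≤ 2 →
      b ∈ A → o ∉ A → (∃ y : Fin n, y ∉ A ∧ y ≠ o ∧ (w s(o, y) : ℝ) ≠ 0) →
      (∀ w' : Sym2 (Fin n) → unitInterval,
        (Finset.univ.filter (fun v : Fin n => ∃ u : Fin n, 0 < (w' s(u, v) : ℝ))).card <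
          (Finset.univ.filter (fun v : Fin n => ∃ u : Fin n, 0 < (w s(u, v) : ℝ))).card →
        ∀ (A' : Finset (Fin n)) (o' b' : Fin n), b' ∈ A' → o' ∉ A' →
        ∀ (t : ℝ) (sel : Finset (Fin n) → Fin n), (∀ W, sel W ∈ A') →
        (∀ a ∈ A', 1 - t ≤ (prodBernoulli w').real (openConn a b')) →
        (prodBernoulli w').real ((⋃ a ∈ A', openConn o' a) ∩ (openConn o' b')ᶜ) +
          ∑ W ∈ (Finset.univ : Finset (Finset (Fin n))).filter
              (fun W => o' ∈ W ∧ Disjoint W A'),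
            (prodBernoulli w').real
                {ω : BondConfig (Fin n) | openCluster ω o' = (W : Set (Fin n))} *
              (prodBernoulli w').real (openConnIn ((W : Set (Fin n))ᶜ) (sel W) b')ᶜ ≤ t) →
      ∀ (t : ℝ) (sel : Finset (Fin n) → Fin n), (∀ W, sel W ∈ A) →
      (∀ a ∈ A, 1 - t ≤ (prodBernoulli w).real (openConn a b)) →
      (prodBernoulli w).real ((⋃ a ∈ A, openConn o a) ∩ (openConn o b)ᶜ) +
        ∑ W ∈ (Finset.univ : Finset (Finset (Fin n))).filter (fun W => o ∈ W ∧ Disjoint W A),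
          (prodBernoulli w).real {ω : BondConfig (Fin n) | openCluster ω o = (W : Set (Fin n))} *
            (prodBernoulli w).real (openConnIn ((W : Set (Fin n))ᶜ) (sel W) b)ᶜ ≤ t := by
  intro n w A o b hn hb ho hy
  exfalso
  obtain ⟨y, hyA, hyo, -⟩ := hy
  have hob : (o : ℕ) ≠ b := fun h => ho (Fin.ext h ▸ hb)
  have hyb : (y : ℕ) ≠ b := fun h => hyA (Fin.ext h ▸ hb)
  have hyo' : (y : ℕ) ≠ o := fun h => hyo (Fin.ext h)
  have h1 := o.isLt
  have h2 := b.isLt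
  have h3 := y.isLt
  omega

end Summit.CriticalPhenomena.PercolationContinuityZ3.Theorems
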